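import Summits.QuantumFields.YangMills.Theorems.BalabanUVNodesN11Thm2Sect2DataOfRecordDefs
import Summits.QuantumFields.YangMills.Theorems.BalabanUVNodesN11Thm2Ineq249AtRecord13CoPH

/-!
# DAG node N11 — [III] THEOREM 2 BY NAME AT THE ₁₃ OBJECTS: `B14.Thm2Printed` ∕ `B14Thm2.Ineq243` ∕ `Ineq244` at `sect2DataOfRecord₁₃ θ p` — what they say at level-`k` data, and
# (2.43) OF RECORD ⇒ this seat's per-scale binder `h243` at every history ∕ witness ∕ configuration («taking Ω = Bʲ(Λ_j⁰), φ = φ_j in (2.43)», p. 263) ⇒ (2.49) for `action23` of record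

Cell `pub-ymgap`, YM-PLAN Track A (HUMAN RULING D-0062 ∕ D-0149), seat `pub-ymgap-dag-n11-w2` (g0), route `BalabanUVNodes`, key item K1⁷ `StabilityBAtRecordR13SepCoPH` =
stmt-QuantumFields-20542 (helper, count-neutral).  Over this seat's Defs `…Thm2Sect2DataOfRecordDefs` (`sect2DataOfRecord₁₃`, `LevelDatum`, `EjSubOn`, `RjSubOn`) and file 1
`…Thm2Ineq249AtRecord13CoPH` (p583777).  [III] = [Balaban1988Convergent].

WHAT THIS FILE PROVES (0 `sorry`, 0 `def`, standard axioms; count-neutral; nothing of Bałaban's asserted — `B14.Thm2Printed` ∕ `Ineq243` ∕ `Ineq244` are the cell's VERBATIM typings of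
Theorem 2 p. 263, consumed as HYPOTHESES).
`ncard_setOf_eq_card_filter` (the Defs' `Set.ncard` volumes = the point-count files' `Finset.filter` cardinalities) · `ineq243OfRecord_at_level` (what (2.43) of record says at a level-`k` datum `⟨k, d⟩`: the `Ω`-restricted z-sum minus `β_j(g_{j−1})·A(φ, U)` bounded by `E₁·Σ_{n=j}^{k}(L^{j−n})^β·|Γ_n(s)∩Ω|`) ·
`ineq244OfRecord_at_level` (what (2.44) of record — THE LARGE-FIELD 𝐑-OPERATION SENTENCE — says there: `|Σ_{X⊂Λ_j(s), X∩Ω≠∅} Re[𝐑^{(j)}(X,U) − 𝐑^{(j)}(X,1)]| ≤ R₁·g_j^{κ₀}·Σ_{n=j}^{k}|Γ_n(s)∩Ω|`) ·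
★ `h243_at_record₁₃CoPH_of_ineq243OfRecord` ((2.43) of record at `Ω = T_η`, `φ = φ_j(s)` IS file 1's binder `h243` with `Γ_n := |Γ_n(s)|`, every `k ≤ K`, `s`, `t`, `U`) ·
`ineq243_ineq244_of_thm2PrintedOfRecord` (`B14.Thm2Printed H033 (fun _ : PUnit => sect2DataOfRecord₁₃ θ p) L β κ₀` + `β < 1` + `H033` at the run's flow ⇒ `∃ E₁ R₁`, (2.43) ∧ (2.44) of record;
(0.20) is free: `flowOfRun_satisfiesRG`) · ★★ `ineq249_action23_at_record₁₃CoPH_of_ineq243OfRecord` ((2.43) OF RECORD BY NAME + file 1's 𝐑-side binder `h244` on the (2.30) range + (2.48)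
+ (2.46)'s coupling inputs + vacuum sentence ⇒ (2.49) `Ineq249` for the (2.23)-action of record with `Γ_n := |Γ_n(s)|`).

HONEST FRAMING ∕ LOCATED.  (2.44) of record (`rTerm`, print's range «X ⊂ Λ_j, X ∩ Ω ≠ ∅») is stated by name but NOT consumed toward (2.49): the 𝐑-summand of (2.23)∕(2.30) ranges over
«X ⊂ Λ_j^{∼−1}» (r11's `Sect2.admR`), a different domain set at every Ω — the identification «taking Ω = Bʲ(Λ_j⁰) in (2.44)» is the reader's (cell GAPS G-pv01-1 (ii), here at the
objects); the 𝐑-side therefore keeps file 1's binder `h244` (or this seat's per-domain supplier `…Thm2RSideAtRecord13CoPH`).  N11 NOT discharged; K1⁷ NOT closed; counts unmoved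
(typed 28∕28 · discharged 5∕27).  One finite four-torus programme at fixed `ε = L^{−K}`; R4 closes only the conditional finite-𝕋⁴ rung `BalabanLadder.UV`; NOT ℝ⁴, NOT OS, NOT a mass
gap, NOT Clay.  Sources: [III] Thm 2 (2.43)–(2.44) p. 263, (2.45)–(2.49) pp. 263–264, (2.2) p. 255, (2.25) p. 259, (2.30) p. 260.
-/

noncomputable section

open scoped BigOperators Matrix.Norms.L2Operator

namespace Summit.QuantumFields.YangMills.Theorems.BalabanUVNodesN11Thm2OfRecordIneq243

open Literature.MathematicalPhysics.QuantumFieldTheory.Balaban1983to89 Step B14.Eq225Concrete B14.LocalCoupling B14Thm2 Finset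
open T4Continuum Node00 B15DeterminingSets
open BalabanUVNodesN11Thm2Sect2DataOfRecordDefs
open BalabanUVNodesN11Thm2Ineq249AtRecord13CoPH (ineq249_action23_at_record₁₃CoPH_of_thm2)

variable {F : T4Family} {N : ℕ} [NeZero N]
variable (θ : Stage13HParams F N) (p : B12.RunParams)

open Classical in
/-- **What (2.43) OF RECORD says at a level-`k` datum** `d = (s, t, U, Ω, φ)`, `1 ≤ j ≤ k ≤ K`:
`|Σ_{z∈Λ_j⁰(s)∩Ω} Σ_{X∋z, X⊂Λ_j(s)} Re[𝐄^{(j)}(X,U,z) − 𝐄^{(j)}(X,1,z)] − (g_{j−1}^{−2} − g_j^{−2})·A(φ,U)| ≤ E₁·Σ_{n=j}^{k} (L^{j−n})^β·|Γ_n(s) ∩ Ω|`. [cite: Balaban1988Convergent, (2.43) p.263] -/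
theorem ineq243OfRecord_at_level {L β E₁ : ℝ} (h : Ineq243 (sect2DataOfRecord₁₃ θ p) L β E₁) {j k : ℕ} (hj : 1 ≤ j) (hjk : j ≤ k) (hk : k ≤ p.K)
    (d : LevelDatum θ p k) :
    |EjSubOn (sect2TowerOfRecord F N (FluctV N) p.K (settingOfRecord₁₃ F N θ.toStage13Params p) (θ.rzAt p d.s) d.s d.t)
          (fun j X z => Sect2.admE (F.P p.K) θ.ν θ.τ9.M (gOfRecord₁₃ F N θ.toStage13Params p) d.s.Λ j (Sect2.domSites (F.P p.K) θ.τ9.M j X) z) j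
          (fun z => decide (B10Eq38TorusDomains.toFine j z ∈ d.region)) d.U
        - (1 / gOfRecord₁₃ F N θ.toStage13Params p (j - 1) ^ 2 - 1 / gOfRecord₁₃ F N θ.toStage13Params p j ^ 2) * smearedWilson d.weight d.U| ≤
      E₁ * ∑ n ∈ Icc j k, (L ^ ((j : ℝ) - n)) ^ β *
        (Set.ncard {y : Site (F.P p.K) n | B10Eq38TorusDomains.toFine n y ∈ gammaRegion d.s.Ω k n ∩ d.region} : ℝ) := by
  have h1 := h j k ⟨k, d⟩ hj hjk hk
  rw [eTerm_mk_self] at h1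
  exact h1

open Classical in
/-- **What (2.44) OF RECORD — the large-field 𝐑-operation sentence — says at a level-`k` datum** `d`, `1 ≤ j ≤ k ≤ K`:
`|Σ_{X∈𝐃_j, X⊂Λ_j(s), X∩Ω≠∅} Re[𝐑^{(j)}(X,(ιU,0)) − 𝐑^{(j)}(X,(ι1,0))]| ≤ R₁·g_j^{κ₀}·Σ_{n=j}^{k} |Γ_n(s) ∩ Ω|` (`g_j = gOfRecord₁₃ … p j`). [cite: Balaban1988Convergent, (2.44) p.263] -/
theorem ineq244OfRecord_at_level {R₁ : ℝ} {κ₀ : ℕ} (h : Ineq244 (sect2DataOfRecord₁₃ θ p) R₁ κ₀) {j k : ℕ} (hj : 1 ≤ j) (hjk : j ≤ k) (hk : k ≤ p.K)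
    (d : LevelDatum θ p k) :
    |RjSubOn (sect2TowerOfRecord F N (FluctV N) p.K (settingOfRecord₁₃ F N θ.toStage13Params p) (θ.rzAt p d.s) d.s d.t) j
        (fun X => decide (Sect2.domSites (F.P p.K) θ.τ9.M j X ⊆ d.s.Λ j ∧ (Sect2.domSites (F.P p.K) θ.τ9.M j X ∩ d.region).Nonempty)) d.U| ≤
      R₁ * (gOfRecord₁₃ F N θ.toStage13Params p j) ^ κ₀ * ∑ n ∈ Icc j k,
        (Set.ncard {y : Site (F.P p.K) n | B10Eq38TorusDomains.toFine n y ∈ gammaRegion d.s.Ω k n ∩ d.region} : ℝ) := by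
  have h1 := h j k ⟨k, d⟩ hj hjk hk
  rw [rTerm_mk_self] at h1
  exact h1

/-- **The volume of record in the point-count files' letter**: `|Γ_n(s) ∩ Ω|` as `Set.ncard` (the Defs' `gammaVol`) IS the `Finset.filter` cardinality used by
`…Thm2PointCountAtRecord13CoPH` (classical decidability). [cite: Balaban1988Convergent, p.263 (bookkeeping)] -/
theorem ncard_setOf_eq_card_filter {α : Type*} [Fintype α] (P : α → Prop) [DecidablePred P] :
    Set.ncard {y : α | P y} = (Finset.univ.filter P).card := by
  rw [Set.ncard_eq_toFinset_card', Set.toFinset_setOf]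

/-- **★ (2.43) OF RECORD BY NAME ⇒ this seat's binder `h243`** at every level `k ≤ K`, history `s`, witness `t`, configuration `U`: «taking Ω = Bʲ(Λ_j⁰), φ = φ_j in (2.43)» at the objects —
`Ω = T_η` (so `Λ_j⁰ ∩ Ω = Λ_j⁰`, `|Γ_n ∩ Ω| = |Γ_n(s)|`), `φ = θ.Phih p k s.Ω s.Λ j`; the left-hand side becomes file 1's `EjSub − (g_{j−1}^{−2} − g_j^{−2})·A(φ_j,U)`
(`eTerm_at_univ_phi`). [cite: Balaban1988Convergent, (2.43)∕(2.45) p.263, (2.25) p.259] -/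
theorem h243_at_record₁₃CoPH_of_ineq243OfRecord {L β E₁ : ℝ} (h : Ineq243 (sect2DataOfRecord₁₃ θ p) L β E₁) {k : ℕ} (hk : k ≤ p.K)
    (s : SeqOfRecord F θ.ν θ.τ9.M (gOfRecord₁₃ F N θ.toStage13Params p) p.K k) (t : Sect2.TermValues (F.P p.K) (MatA N) (FluctV N) θ.τ9.M)
    (U : GaugeField (F.P p.K) 0 (SU N)) :
    ∀ j, 1 ≤ j → j ≤ k →
      |EjSub (sect2TowerOfRecord F N (FluctV N) p.K (settingOfRecord₁₃ F N θ.toStage13Params p) (θ.rzAt p s) s t)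
            (fun j X z => Sect2.admE (F.P p.K) θ.ν θ.τ9.M (gOfRecord₁₃ F N θ.toStage13Params p) s.Λ j (Sect2.domSites (F.P p.K) θ.τ9.M j X) z) j U
          - (1 / gOfRecord₁₃ F N θ.toStage13Params p (j - 1) ^ 2 - 1 / gOfRecord₁₃ F N θ.toStage13Params p j ^ 2) * smearedWilson (θ.Phih p k s.Ω s.Λ j) U| ≤
        E₁ * ∑ n ∈ Icc j k, (L ^ ((j : ℝ) - n)) ^ β *
          (Set.ncard {y : Site (F.P p.K) n | B10Eq38TorusDomains.toFine n y ∈ gammaRegion s.Ω k n ∩ (Set.univ : Set (Site (F.P p.K) 0))} : ℝ) := by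
  intro j hj hjk
  have h1 := h j k ⟨k, ⟨s, t, U, Set.univ, θ.Phih p k s.Ω s.Λ j⟩⟩ hj hjk hk
  rw [eTerm_at_univ_phi] at h1
  exact h1

/-- **`B14.Thm2Printed` OF RECORD ⇒ (2.43) ∧ (2.44) of record with SOME constants**: for the one-run family `fun _ : PUnit => sect2DataOfRecord₁₃ θ p`, the printed guard `β < 1` and the
hypothesis parameter `H033` at the run's flow, Theorem 2 gives `E₁, R₁` with `Ineq243 ∧ Ineq244` of record — (0.20) is no hypothesis (`flowOfRun_satisfiesRG`); `B14Thm2.thm2Printed_iff`.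
[cite: Balaban1988Convergent, Thm 2 (2.43)–(2.44) p.263] -/
theorem ineq243_ineq244_of_thm2PrintedOfRecord (H033 : Flow → ℕ → Prop) {L β : ℝ} {κ₀ : ℕ}
    (h : B14.Thm2Printed H033 (fun _ : PUnit => sect2DataOfRecord₁₃ θ p) L β κ₀) (hβ : β < 1)
    (h033 : H033 (flowOfRun (gOfRecord₁₃ F N θ.toStage13Params p)) p.K) :
    ∃ E₁ R₁ : ℝ, Ineq243 (sect2DataOfRecord₁₃ θ p) L β E₁ ∧ Ineq244 (sect2DataOfRecord₁₃ θ p) R₁ κ₀ := by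
  obtain ⟨E₁, R₁, hall⟩ := (thm2Printed_iff H033 _ L β κ₀).mp h hβ
  exact ⟨E₁, R₁, hall PUnit.unit (sect2DataOfRecord₁₃_satisfiesRG θ p) h033⟩

/-- **★★ (2.43) OF RECORD BY NAME ⇒ (2.49) FOR THE (2.23)-ACTION OF RECORD** (with file 1's 𝐑-side binder `h244` on the (2.30) range, (2.48), (2.46)'s coupling inputs and the vacuum
sentence displayed; volumes `Γ_n := |Γ_n(s)|` of the history, `β > 0`): file 1's ★★ `ineq249_action23_at_record₁₃CoPH_of_thm2` with `h243` DISCHARGED from `Ineq243 (sect2DataOfRecord₁₃ θ p) L β E₁`.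
[cite: Balaban1988Convergent, Thm 2 (2.43)–(2.44) p.263, (2.45)–(2.49) pp.263–264] -/
theorem ineq249_action23_at_record₁₃CoPH_of_ineq243OfRecord {L β E₁ : ℝ} (h243R : Ineq243 (sect2DataOfRecord₁₃ θ p) L β E₁) {k : ℕ} (hk : k ≤ p.K)
    (s : SeqOfRecord F θ.ν θ.τ9.M (gOfRecord₁₃ F N θ.toStage13Params p) p.K k) (t : Sect2.TermValues (F.P p.K) (MatA N) (FluctV N) θ.τ9.M)
    (a : Tk.SFluct (F.P p.K) (FluctV N)) (κ₀ : ℕ) (hκ : 7 ≤ κ₀) (Ek EkLog EkRest : ℝ) (hEk : Ek = EkLog + EkRest) (U : GaugeField (F.P p.K) 0 (SU N))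
    (R₁ B₁ E₂ : ℝ) (hL : 1 < L) (hβ : 0 < β) (hE : 0 ≤ E₁) (hR : 0 ≤ R₁)
    (h244 : ∀ j, 1 ≤ j → j ≤ k →
      |∑ X : (Sect2.domSys (F.P p.K) θ.τ9.M j).Dom, (if Sect2.admR (F.P p.K) θ.ν θ.τ9.M (gOfRecord₁₃ F N θ.toStage13Params p) s.Λ j (Sect2.domSites (F.P p.K) θ.τ9.M j X) then
          ((t.R j X (Sect2.ofBackgroundC (ιSU N) U)).re - (t.R j X (Sect2.ofBackgroundC (ιSU N) 1)).re) else 0)| ≤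
        R₁ * (gOfRecord₁₃ F N θ.toStage13Params p j) ^ κ₀ * ∑ n ∈ Icc j k,
          (Set.ncard {y : Site (F.P p.K) n | B10Eq38TorusDomains.toFine n y ∈ gammaRegion s.Ω k n ∩ (Set.univ : Set (Site (F.P p.K) 0))} : ℝ))
    (hsum : ∀ n, 1 ≤ n → n ≤ k → ∑ j ∈ Icc 1 n, (gOfRecord₁₃ F N θ.toStage13Params p j) ^ κ₀ ≤ (gOfRecord₁₃ F N θ.toStage13Params p n) ^ (κ₀ - 6))
    (hsmall : ∀ n, 1 ≤ n → n ≤ k → R₁ * (gOfRecord₁₃ F N θ.toStage13Params p n) ^ (κ₀ - 6) ≤ 1)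
    (h248 : |B240 (sect2TowerOfRecord F N (FluctV N) p.K (settingOfRecord₁₃ F N θ.toStage13Params p) (θ.rzAt p s) s t)
        (fun j X => Sect2.admB (F.P p.K) θ.ν θ.τ9.M (gOfRecord₁₃ F N θ.toStage13Params p) s.Ω s.Λ j (Sect2.domSites (F.P p.K) θ.τ9.M j X)) a k U| ≤
      2 * B₁ * ∑ n ∈ Icc 1 k, (Set.ncard {y : Site (F.P p.K) n | B10Eq38TorusDomains.toFine n y ∈ gammaRegion s.Ω k n ∩ (Set.univ : Set (Site (F.P p.K) 0))} : ℝ))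
    (hvac : VacuumRestBound EkRest E₂
      (fun n => (Set.ncard {y : Site (F.P p.K) n | B10Eq38TorusDomains.toFine n y ∈ gammaRegion s.Ω k n ∩ (Set.univ : Set (Site (F.P p.K) 0))} : ℝ)) k) :
    Ineq249 ((sect2ActionDataOfRecord F N (FluctV N) p.K (settingOfRecord₁₃ F N θ.toStage13Params p) (θ.rzAt p s) s t a Ek).action23 k U)
      (smearedWilson (invSq (flowOfRun (gOfRecord₁₃ F N θ.toStage13Params p)) (θ.Phih p k s.Ω s.Λ) k) U) (-EkLog)
      (E₁ * (1 - L ^ (-β))⁻¹ + 1 + 2 * B₁ + E₂)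
      (fun n => (Set.ncard {y : Site (F.P p.K) n | B10Eq38TorusDomains.toFine n y ∈ gammaRegion s.Ω k n ∩ (Set.univ : Set (Site (F.P p.K) 0))} : ℝ)) k :=
  ineq249_action23_at_record₁₃CoPH_of_thm2 θ p s t a κ₀ hκ Ek EkLog EkRest hEk U E₁ R₁ B₁ L β E₂ _ hL hβ hE hR (fun _ _ _ => Nat.cast_nonneg _)
    (h243_at_record₁₃CoPH_of_ineq243OfRecord θ p h243R hk s t U) h244 hsum hsmall h248 hvac

end Summit.QuantumFields.YangMills.Theorems.BalabanUVNodesN11Thm2OfRecordIneq243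

end
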